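import Summits.Parity.GeneralizedHardyLittlewood.Theorems.BeyondDiagonalBeatsQuarter.OffDiagDualTruncationTails
import HarnessLib

/-!
# Route `PrimeLevelFamEdge`, crux K_B (stmt-Parity-20343), line `diagonal_kernel_split` rev 4, plan Ω,
# lemma **L2 `OffDiagDualTruncation`** (part 1c): the truncation statement from DERIVATIVE COSTS

The form in which OMEGA-BLUEPRINT §2–§3 L2 uses the tails of part 1b: if the weight `Φ` (a dyadic box weight
`Φ_i` of d5) has `L¹` derivative costs
`A_k = ∫∫|∂₁^kΦ| ≤ S·D^k` and `B_k = ∫∫|∂₁^k∂₂²Φ| ≤ S·D^k·E`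
(`D` = cost of one `∂₁`, `E` = cost of `∂₂²`, `S` = size), then with the DUAL LENGTH `H₁ := c·D/(2π)` and any
loss factor `Q ≥ 1` (downstream `Q = q^{ε}`), the dual sum truncated at `|h₁| ≤ H`, `H ≥ H₁·Q`, has tail
`Σ_{h ∈ ℤ², |h₁| > H} ‖Φ̂(h₁/c,h₂/c)‖ ≤ 2S(1 + c²E/12)·H·Q^{−k}`
(`tsum_tail_norm_fourier2_le_of_cost`; finite form `sum_tail_norm_fourier2_le_of_cost`), and the same with the
multiplicities `N ≤ N₀` of the dual side (`…_mul_le_of_cost`). The `h₂`-tail is the statement for the transpose.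
The derivative costs of `OffDiag.boxWeight` themselves (`D ≍ (1+X+Z)/K_j`, BLUEPRINT §2) are L2c, not here.

Elementary; PROVED; theorems only. Helper; closes nothing.
«The programme SEARCHES and TYPES; no claim about Landau–Siegel zeros, Theorems 1–2 of arXiv:2211.02515 or
a repaired Margin232 until a kernel theorem says so.»
-/

noncomputable section

open Real MeasureTheory Complex Finset Set
open scoped FourierTransform Topology ContDiff

namespace Summit.Parity.GeneralizedHardyLittlewood.Theorems.BeyondDiagonalBeatsQuarter.OffDiagPoissonTwisted

open Literature.NumberTheory.Sieve.FriedlanderIwaniecPrimes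

section Cost

variable {Φ : ℝ → ℝ → ℂ}

/-- The arithmetic of the dual length: if `c·D/(2π)·Q ≤ H` with `Q ≥ 1`, `H ≥ 1`, `k ≥ 1`, then
`(c/2π)^k · D^k · H^{1−k} ≤ H · Q^{−k}`. [folklore] -/
theorem pow_mul_pow_inv_le_of_dualLength {c D Q : ℝ} {H k : ℕ} (hc : 0 < c) (hD : 0 ≤ D) (hQ : 1 ≤ Q)
    (hH : 1 ≤ H) (hk : 1 ≤ k) (hlen : c * D / (2 * π) * Q ≤ H) :
    (c / (2 * π)) ^ k * D ^ k * ((H : ℝ) ^ (k - 1))⁻¹ ≤ (H : ℝ) * (Q ^ k)⁻¹ := by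
  have hHr : (1 : ℝ) ≤ H := by exact_mod_cast hH
  have hH0 : (0 : ℝ) < H := by linarith
  have hQ0 : 0 < Q := by linarith
  have hx0 : 0 ≤ c * D / (2 * π) := by positivity
  -- `(cD/2π)^k ≤ (H/Q)^k`
  have h1 : (c / (2 * π)) ^ k * D ^ k = (c * D / (2 * π)) ^ k := by rw [← mul_pow]; ring
  have h2 : c * D / (2 * π) ≤ H / Q := by rwa [le_div_iff₀ hQ0]
  have h3 : (c * D / (2 * π)) ^ k ≤ ((H : ℝ) / Q) ^ k := pow_le_pow_left₀ hx0 h2 k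
  rw [h1]
  calc (c * D / (2 * π)) ^ k * ((H : ℝ) ^ (k - 1))⁻¹
      ≤ ((H : ℝ) / Q) ^ k * ((H : ℝ) ^ (k - 1))⁻¹ :=
        mul_le_mul_of_nonneg_right h3 (by positivity)
    _ = (H : ℝ) * (Q ^ k)⁻¹ := by
        rw [div_pow]
        have hk' : k = (k - 1) + 1 := by omega
        rw [hk', pow_succ, Nat.add_sub_cancel]
        field_simp

/-- **Truncation from derivative costs** (finite form). For `uncurry Φ` smooth of compact support, `c > 0`,
`k ≥ 2`, costs `A_k ≤ S·D^k`, `B_k ≤ S·D^k·E` (`S, D, E ≥ 0`), a loss factor `Q ≥ 1` and a truncation point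
`H ≥ max(1, cDQ/(2π))`: for every finite `T ⊆ {h ∈ ℤ² : |h₁| > H}`,
`Σ_{h ∈ T} ‖Φ̂(h₁/c,h₂/c)‖ ≤ 2S(1 + c²E/12)·H·Q^{−k}`. [folklore] -/
theorem sum_tail_norm_fourier2_le_of_cost (hΦ : ContDiff ℝ ∞ (Function.uncurry Φ))
    (hΦc : HasCompactSupport (Function.uncurry Φ)) {c : ℝ} (hc : 0 < c) {k H : ℕ} (hk : 2 ≤ k)
    (hH : 1 ≤ H) {S D E Q : ℝ} (hS : 0 ≤ S) (hD : 0 ≤ D) (hE : 0 ≤ E) (hQ : 1 ≤ Q)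
    (hA : (∫ t₂, ∫ t₁, ‖iteratedDeriv k (fun s => Φ s t₂) t₁‖) ≤ S * D ^ k)
    (hB : (∫ t₂, ∫ t₁, ‖iteratedDeriv k (fun s => iteratedDeriv 2 (Φ s) t₂) t₁‖) ≤ S * D ^ k * E)
    (hlen : c * D / (2 * π) * Q ≤ H) (T : Finset (ℤ × ℤ)) (hT : ∀ h ∈ T, (H : ℤ) < |h.1|) :
    ∑ h ∈ T, ‖fourier2 Φ (h.1 / c) (h.2 / c)‖ ≤ 2 * S * (1 + c ^ 2 * E / 12) * H * (Q ^ k)⁻¹ := by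
  have htail := sum_tail_norm_fourier2_le hΦ hΦc hc hk hH T hT
  have hlen' := pow_mul_pow_inv_le_of_dualLength hc hD hQ hH (by omega : 1 ≤ k) hlen
  have hmid : (∫ t₂, ∫ t₁, ‖iteratedDeriv k (fun s => Φ s t₂) t₁‖) +
      c ^ 2 / 12 * ∫ t₂, ∫ t₁, ‖iteratedDeriv k (fun s => iteratedDeriv 2 (Φ s) t₂) t₁‖ ≤
        S * D ^ k * (1 + c ^ 2 * E / 12) := by
    have h2 : c ^ 2 / 12 * (∫ t₂, ∫ t₁, ‖iteratedDeriv k (fun s => iteratedDeriv 2 (Φ s) t₂) t₁‖) ≤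
        c ^ 2 / 12 * (S * D ^ k * E) := mul_le_mul_of_nonneg_left hB (by positivity)
    nlinarith [hA, h2]
  calc ∑ h ∈ T, ‖fourier2 Φ (h.1 / c) (h.2 / c)‖
      ≤ 2 * (c / (2 * π)) ^ k * (S * D ^ k * (1 + c ^ 2 * E / 12)) * ((H : ℝ) ^ (k - 1))⁻¹ := by
        refine htail.trans ?_
        gcongr
    _ = 2 * S * (1 + c ^ 2 * E / 12) * ((c / (2 * π)) ^ k * D ^ k * ((H : ℝ) ^ (k - 1))⁻¹) := by ring
    _ ≤ 2 * S * (1 + c ^ 2 * E / 12) * ((H : ℝ) * (Q ^ k)⁻¹) :=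
        mul_le_mul_of_nonneg_left hlen' (by positivity)
    _ = _ := by ring

/-- **Truncation from derivative costs** (series form):
`Σ_{h ∈ ℤ², |h₁| > H} ‖Φ̂(h₁/c,h₂/c)‖ ≤ 2S(1 + c²E/12)·H·Q^{−k}` under the hypotheses of
`sum_tail_norm_fourier2_le_of_cost`. [folklore] -/
theorem tsum_tail_norm_fourier2_le_of_cost (hΦ : ContDiff ℝ ∞ (Function.uncurry Φ))
    (hΦc : HasCompactSupport (Function.uncurry Φ)) {c : ℝ} (hc : 0 < c) {k H : ℕ} (hk : 2 ≤ k)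
    (hH : 1 ≤ H) {S D E Q : ℝ} (hS : 0 ≤ S) (hD : 0 ≤ D) (hE : 0 ≤ E) (hQ : 1 ≤ Q)
    (hA : (∫ t₂, ∫ t₁, ‖iteratedDeriv k (fun s => Φ s t₂) t₁‖) ≤ S * D ^ k)
    (hB : (∫ t₂, ∫ t₁, ‖iteratedDeriv k (fun s => iteratedDeriv 2 (Φ s) t₂) t₁‖) ≤ S * D ^ k * E)
    (hlen : c * D / (2 * π) * Q ≤ H) :
    ∑' h : ℤ × ℤ, (if (H : ℤ) < |h.1| then ‖fourier2 Φ (h.1 / c) (h.2 / c)‖ else 0) ≤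
      2 * S * (1 + c ^ 2 * E / 12) * H * (Q ^ k)⁻¹ := by
  classical
  refine Real.tsum_le_of_sum_le (fun h => by split_ifs <;> positivity) fun T => ?_
  rw [← Finset.sum_filter]
  exact sum_tail_norm_fourier2_le_of_cost hΦ hΦc hc hk hH hS hD hE hQ hA hB hlen _
    fun h hh => (Finset.mem_filter.mp hh).2

/-- **Truncation of the weighted dual sum** (multiplicities `‖N(h)‖ ≤ N₀`, e.g. `N₀ = 1` on the coprime stratum,
`N₀ = c` always): `Σ_{|h₁| > H} ‖Φ̂(h/c)·N(h)‖ ≤ 2S(1 + c²E/12)·H·Q^{−k}·N₀`. [folklore] -/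
theorem tsum_tail_norm_fourier2_mul_le_of_cost (hΦ : ContDiff ℝ ∞ (Function.uncurry Φ))
    (hΦc : HasCompactSupport (Function.uncurry Φ)) {c : ℝ} (hc : 0 < c) {k H : ℕ} (hk : 2 ≤ k)
    (hH : 1 ≤ H) {S D E Q : ℝ} (hS : 0 ≤ S) (hD : 0 ≤ D) (hE : 0 ≤ E) (hQ : 1 ≤ Q)
    (hA : (∫ t₂, ∫ t₁, ‖iteratedDeriv k (fun s => Φ s t₂) t₁‖) ≤ S * D ^ k)
    (hB : (∫ t₂, ∫ t₁, ‖iteratedDeriv k (fun s => iteratedDeriv 2 (Φ s) t₂) t₁‖) ≤ S * D ^ k * E)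
    (hlen : c * D / (2 * π) * Q ≤ H) {N : ℤ × ℤ → ℂ} {N₀ : ℝ} (hN : ∀ h, ‖N h‖ ≤ N₀) :
    ∑' h : ℤ × ℤ, (if (H : ℤ) < |h.1| then ‖fourier2 Φ (h.1 / c) (h.2 / c) * N h‖ else 0) ≤
      2 * S * (1 + c ^ 2 * E / 12) * H * (Q ^ k)⁻¹ * N₀ := by
  classical
  have hN0 : 0 ≤ N₀ := (norm_nonneg _).trans (hN 0)
  have hpt : ∀ h : ℤ × ℤ, (if (H : ℤ) < |h.1| then ‖fourier2 Φ (h.1 / c) (h.2 / c) * N h‖ else 0) ≤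
      (if (H : ℤ) < |h.1| then ‖fourier2 Φ (h.1 / c) (h.2 / c)‖ else 0) * N₀ := by
    intro h
    split_ifs
    · rw [norm_mul]; exact mul_le_mul_of_nonneg_left (hN h) (norm_nonneg _)
    · rw [zero_mul]
  have hs₁ : Summable fun h : ℤ × ℤ =>
      (if (H : ℤ) < |h.1| then ‖fourier2 Φ (h.1 / c) (h.2 / c)‖ else 0) * N₀ :=
    (summable_tail_norm_fourier2 hΦ hΦc hc H).mul_right N₀
  have hs₀ : Summable fun h : ℤ × ℤ =>
      (if (H : ℤ) < |h.1| then ‖fourier2 Φ (h.1 / c) (h.2 / c) * N h‖ else 0) :=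
    Summable.of_nonneg_of_le (fun h => by split_ifs <;> positivity) hpt hs₁
  calc ∑' h : ℤ × ℤ, (if (H : ℤ) < |h.1| then ‖fourier2 Φ (h.1 / c) (h.2 / c) * N h‖ else 0)
      ≤ ∑' h : ℤ × ℤ, (if (H : ℤ) < |h.1| then ‖fourier2 Φ (h.1 / c) (h.2 / c)‖ else 0) * N₀ :=
        hs₀.tsum_le_tsum hpt hs₁
    _ = (∑' h : ℤ × ℤ, (if (H : ℤ) < |h.1| then ‖fourier2 Φ (h.1 / c) (h.2 / c)‖ else 0)) * N₀ :=
        tsum_mul_right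
    _ ≤ _ := mul_le_mul_of_nonneg_right
        (tsum_tail_norm_fourier2_le_of_cost hΦ hΦc hc hk hH hS hD hE hQ hA hB hlen) hN0

end Cost

end Summit.Parity.GeneralizedHardyLittlewood.Theorems.BeyondDiagonalBeatsQuarter.OffDiagPoissonTwisted
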